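import Summits.CriticalPhenomena.PercolationContinuityZ3.Theorems.Transplant.SkelConcFaceContact
import Summits.CriticalPhenomena.PercolationContinuityZ3.Theorems.Transplant.SkelConcFaceObl
import Summits.CriticalPhenomena.PercolationContinuityZ3.Theorems.Transplant.SkelConcKitsRoom
import HarnessLib

/-!
# Kozma–Nitzan Lemma 12 over a planar skeleton — the face step's KIT CLAUSES DISCHARGED (hp-8 (F) part C; generic twin of the
# product's `BoxProdZ2ConcFace.hkits_face`)

builds on p205010 (kernel theorem, internal audit signed; external expert review pending) — nothing in this file uses p205010.
Lane `prim-bschramm`, typed by the `prim-hp-8` lineage (gen 24); helper file (`--supports stmt-CriticalPhenomena-4575 --as helper`).  NEW FILE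
over `SkelConcKitsRoom` (`SkelI.kitClause_cube'`, L5.15), `SkelConcKits` (`SkelI.hcon_win₂'`), `SkelConcFaceContact` (`Skel.hroute_face`),
`SkelConcFaceData` (`Skel.faceStepW`, `faceRow_hwide`, `winLevel_faceRow_subset_Win`, `isSubbox_faceStepW`).

**`hkits_faceStepW'`** — the `hkits` hypothesis of `Skel.faceOblAt_concSG` (the per-level 8-conjunct kit clause of the face window
`faceStepW … Rlev N Mj L' Sx`, levels `j' ∈ [Mj + 1, Rlev]`, law `S.Wt`, exploration graph `winGraph G w₀ rE`) DISCHARGED from: the Step-I input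
family at the running parameter with margin `am ≤ min(δ₂², δA)` (`hin`), the kit constants (deep slab `ℓs, R', r₀, rs`, count `k, N`), the level
width `tanOff ℓs M ≤ Mj + 1`, the rim numerics (`1 ≤ L' ≤ rM ≤ rE`, `rM + r₀ ≤ rE + L'`, `L_A + ψ M + 1 ≤ L'`), and the inner-route package of
`Skel.hroute_face` at inner accuracy `δA` for every cube centre `oc` (chain estimate `hchain` delivering `δ₂²`, inner kits `hkitsA` under the
route law, count, centre-uniform excess radius, `ℓ1 ∈ Ssc`).  Far and near-rim contacts go to the rim, deep contacts to the inner route.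
[cite: KozmaNitzan2024, §4 Lemma 10 Steps III–V (pp. 19–22), Lemma 11 (pp. 22–23), Lemma 12 (p. 24), p. 30]
-/

noncomputable section

open MeasureTheory
open scoped Classical

namespace Summit.CriticalPhenomena.PercolationContinuityZ3.Theorems

namespace Transplant

namespace Skel

open Literature.Probability.Percolation Literature.Probability.LatticeModels SimpleGraph KNCells KNLevels GadgetSystem Contour ChainPlanar
open Literature.Probability.Percolation.KozmaNitzan
open Literature.Probability.Percolation.KozmaNitzan.Cells (oth oth_ne sgOf sgOf_sign stepVec_apply_fst stepVec_apply_oth eq_oth_of_ne oth_oth)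
open Literature.Probability.Percolation.GM (HOct)
open Literature.Barriers.CriticalPhenomena (graphBall graphBall_finite mem_graphBall_self graphBall_mono)
open BoxProdZ2 (ConcRadiiG InnerRunOK innerCtr innerρ)
open PlanarSkeletonConc
open SkelI (tanOff deepCtr exitDir cubeU)

variable {V : Type} [DecidableEq V] [Countable V] {G : SimpleGraph V} [G.LocallyFinite] (Φ : PlanarSkeletonConc G)

omit [DecidableEq V] [Countable V] [G.LocallyFinite] in
/-- Shrinking a thickened box: `Icc (lo − j' + n) (hi + j' − n) ⊆ Icc (lo − R) (hi + R)` for `j' ≤ R`. [folklore] -/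
theorem Icc_shrink_subset (lo hi : Site 2) {j' R n : ℕ} (hj : j' ≤ R) :
    Finset.Icc (lo - (j' : Site 2) + (n : Site 2)) (hi + (j' : Site 2) - (n : Site 2)) ⊆ Finset.Icc (lo - (R : Site 2)) (hi + (R : Site 2)) := by
  have hjR : (j' : ℤ) ≤ R := by exact_mod_cast hj
  have hn : (0 : ℤ) ≤ n := Nat.cast_nonneg n
  refine Finset.Icc_subset_Icc ?_ ?_ <;> rw [Pi.le_def] <;> intro i <;>
    simp only [Pi.add_apply, Pi.sub_apply, Pi.natCast_apply] <;> linarith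

section History

variable {C : PCells} {w₀ : V} {Λ : ConcRadiiG} {S : KSchA V ℕ}
variable (hΓ : S.Γ = cellGeomSG Φ C w₀ Λ) (hΛ : WFS C Λ)
variable {h : ProbeHistory V} {e : Site 2 × MDir} (hV : S.Valid₂ G h e) {a a' : ℕ} {du : MDir} (hdu : du ∈ S.onward G h (tgt e))
variable {j : ℕ} {o : Finset (Sym2 V)} (Rlev N Mj L' : ℕ)

include hΓ hΛ hV hdu in
/-- **The face step's kit clauses, discharged** (see the module docstring).
[cite: KozmaNitzan2024, §4 Lemma 10 Steps III–V (pp. 19–22), Lemma 11 (pp. 22–23), Lemma 12 (p. 24)] -/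
theorem hkits_faceStepW' (hjK : j + 1 ≤ C.K) (hRlev : Rlev + 3 ≤ 10 * C.s)
    -- the Step-I input family at the running parameter (margin am ≤ δ₂², am ≤ δA) and the kit constants
    {p₀ : unitInterval} (hC : Φ.toPlanarSkeleton.CylSubcritical p₀) (msel : V → ℕ) {Ssc : Finset ℕ} {δ₂ δA am : ℝ} (hδ : 0 < δ₂)
    (ham₂ : am ≤ δ₂ ^ 2) (hamA : am ≤ δA) (hin : ∀ i ∈ Skel.inputIndex Φ Ssc, 1 - am < (bondPercolation G S.p).real (Skel.inputEvent Φ hC msel i))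
    {M : ℕ} (hM : M ∈ Ssc) (hmsel : ∀ t ∈ Φ.types, msel t ≤ M) {ℓs R' r₀ rs k : ℕ} (hMℓ : M + 1 ≤ ℓs) (hMj : tanOff ℓs M ≤ Mj + 1)
    (hR'₁ : Φ.cylRadMax ℓs (ℓs + 2 + 2 * tanOff ℓs M) ≤ R') (hR'₂ : Φ.cylRadMax ℓs (ℓs + 2 + M + fatRadius Φ hC M) ≤ R')
    (hr₀₁ : ℓs + 1 + tanOff ℓs M + R' ≤ r₀) (hr₀₂ : 2 * ℓs + 2 + tanOff ℓs M + M + fatRadius Φ hC M ≤ r₀) (hR : r₀ ≤ Λ.rE a' (tgt e) du)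
    (hrs₁ : ℓs + 2 + tanOff ℓs M + R' ≤ rs) (hrs₂ : 2 * ℓs + 3 + tanOff ℓs M + M + fatRadius Φ hC M ≤ rs)
    (hN : k * (Φ.Δ + 1) ^ (2 * rs) ≤ N)
    (hk : (1 - (S.p : ℝ) ^ (1 + Φ.Δ * ((Φ.Δ + 1) ^ R' + (tanOff ℓs M + 2)) +
      ((Φ.Δ + 1) ^ R' + (tanOff ℓs M + 2)) * (Φ.Δ + 1) ^ fatRadius Φ hC M)) ^ k ≤ δ₂)
    -- the rim numerics
    (hL'1 : 1 ≤ L') (hL'M : L' ≤ Λ.rM a' (tgt e + stepVec du)) (hRL : Λ.rM a' (tgt e + stepVec du) + r₀ ≤ Λ.rE a' (tgt e) du + L')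
    (hMR : Λ.rM a' (tgt e + stepVec du) ≤ Λ.rE a' (tgt e) du)
    {L_A : ℕ} (hLd : L_A + fatRadius Φ hC M + 1 ≤ L')
    -- the inner route package (`Skel.hroute_face`) at inner accuracy δA, for every cube centre `oc`
    {s₁ R'ᵢ ℓ₀ ℓ1 nmax j₀A RlevA N_A L'_A : ℕ} (hℓ1S : ℓ1 ∈ Ssc) (hMℓ₀ : M < ℓ₀) (hs : R'ᵢ + ℓ₀ ≤ s₁) (hs2 : 2 * R'ᵢ ≤ s₁)
    (hℓ1 : M + s₁ + 2 * R'ᵢ + 1 ≤ ℓ1) (hn : 12 * C.r ≤ nmax * s₁) (hbig : Rlev + ℓ1 + 2 * s₁ + (nmax + 3) * R'ᵢ ≤ C.r)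
    (h10s : Rlev + ℓ1 + 3 ≤ 10 * C.s) (hRlA : RlevA + 1 ≤ R'ᵢ) (hℓL : fatRadius Φ hC ℓ1 ≤ L_A) (hLA : 28 * C.r + 2 * Rlev ≤ L_A)
    {τ : ℤˣ} (hτ : (τ : ℤ) = sgOf du) {Δ'ᵢ : ℕ} {ηA : ℝ}
    (hchain : ∀ (oc : V), ∀ n ≤ nmax, ∀ (Wg : Sym2 V → unitInterval) (s : Fin (n + 1) → TStep (winGraph G oc L_A)) (T' : Fin (n + 1) → Finset V) (η' : ℝ),
      (∀ i, (s i).L.o = (s 0).L.o) →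
      (∀ i : Fin n, T' (Fin.castSucc i) ⊆ (s i.succ).L.X 0) →
      (∀ i, T' i ⊆ (s i).T) →
      (∀ i, (s i).KitsAt Wg S.p Δ'ᵢ δA) →
      η' ≤ δA / 2 →
      (∀ i, (prodBernoulli Wg).real (⋃ t ∈ (s i).T \ T' i, openConn (s 0).L.o t) ≤ η') →
      1 - δA < (prodBernoulli Wg).real (s 0).L.reachB →
        1 - δ₂ ^ 2 < (prodBernoulli Wg).real (⋃ t ∈ T' (Fin.last n), openConn (s 0).L.o t))
    (hcountA : 1 / (1 - (S.p : ℝ)) ^ (Δ'ᵢ * N_A) ≤ δA * ((Finset.Icc j₀A RlevA).card : ℝ))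
    (hkitsA : ∀ (oc : V) (mₛ : ℕ) (ca cb : ℤ) (nA : ℕ), mₛ ≤ M → nA ≤ nmax → InnerRunOK C j s₁ R'ᵢ ℓ₀ nA ca cb ℓ1 → ∀ k ≤ nA, ∀ j' ∈ Finset.Icc j₀A RlevA, ∃ (σ : SData V) (Sz : Finset V),
      SHyp (winLData Φ oc L_A ((innerWAD Φ C (tgt e) du oc L_A L'_A ca cb ℓ1 s₁ R'ᵢ ℓ₀ nA RlevA N_A j₀A RlevA (S.Sx G h e a a' du)).alo k)
        ((innerWAD Φ C (tgt e) du oc L_A L'_A ca cb ℓ1 s₁ R'ᵢ ℓ₀ nA RlevA N_A j₀A RlevA (S.Sx G h e a a' du)).ahi k) oc (S.Sx G h e a a' du)) j' σ ∧ σ.N ≤ N_A ∧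
      (1 - (S.p : ℝ) ^ σ.sB) ^ σ.k ≤ δA ∧
      Sz ⊆ (winLData Φ oc L_A ((innerWAD Φ C (tgt e) du oc L_A L'_A ca cb ℓ1 s₁ R'ᵢ ℓ₀ nA RlevA N_A j₀A RlevA (S.Sx G h e a a' du)).alo k)
        ((innerWAD Φ C (tgt e) du oc L_A L'_A ca cb ℓ1 s₁ R'ᵢ ℓ₀ nA RlevA N_A j₀A RlevA (S.Sx G h e a a' du)).ahi k) oc (S.Sx G h e a a' du)).X j' ∧
      Sz ⊆ (innerWAD Φ C (tgt e) du oc L_A L'_A ca cb ℓ1 s₁ R'ᵢ ℓ₀ nA RlevA N_A j₀A RlevA (S.Sx G h e a a' du)).stepDR Φ k ∧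
      (∀ y ∈ σ.K, ∀ e' ∈ σ.seed y, e' ∉ wireSet (↑Sz : Set V)) ∧ (∀ y ∈ σ.K, σ.face y ⊆ Sz) ∧
      (∀ y ∈ σ.K, 1 - 3 * δA ≤ (prodBernoulli (routeW G (S.Wt G h e a a' du j o) (innerQt Φ C (tgt e) du oc L_A s₁ R'ᵢ nA ca cb ℓ1 (Φ.φ oc) ℓ1) (fatSeq Φ hC oc mₛ))).real {ω | ∃ u ∈ σ.face y,
        1 - δA < (prodBernoulli (pinW (routeW G (S.Wt G h e a a' du j o) (innerQt Φ C (tgt e) du oc L_A s₁ R'ᵢ nA ca cb ℓ1 (Φ.φ oc) ℓ1) (fatSeq Φ hC oc mₛ)) (wireSet (↑Sz : Set V)) ω)).real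
          (⋃ z ∈ (innerWAD Φ C (tgt e) du oc L_A L'_A ca cb ℓ1 s₁ R'ᵢ ℓ₀ nA RlevA N_A j₀A RlevA (S.Sx G h e a a' du)).coreE Φ k,
            openConnIn (↑((innerWAD Φ C (tgt e) du oc L_A L'_A ca cb ℓ1 s₁ R'ᵢ ℓ₀ nA RlevA N_A j₀A RlevA (S.Sx G h e a a' du)).stepDR Φ k) : Set V) u z)}))
    (hηA : ηA ≤ δA / 2) {R₁A : ℕ}
    (hR₁A : ∀ (c' : V) (R'' : ℕ), R₁A ≤ R'' → ∀ (Rw : ℕ) (D' A' : Finset V), (∀ d ∈ D', d ∈ graphBall G c' Rw) →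
      (∀ d ∈ D', ∀ d' ∈ D', Φ.φ d - Φ.φ d' ∈ box 2 (50 * C.r)) → A' ⊆ D' → (∀ a ∈ A', a ∈ graphBall G c' (2 * fatRadius Φ hC M)) →
        (bondPercolation G S.p).real (excess G c' R'' D' A') ≤ ηA)
    (hRA : R₁A ≤ L_A - L'_A) :
    let P := faceStepW Φ C w₀ Λ a' (tgt e) du j Rlev N Mj L' (S.Sx G h e a a' du)
    ∀ j' ∈ Finset.Icc P.j₀ P.j₁, ∃ (σ : KNLevels.SData V) (Sz : Finset V),
      KNLevels.SHyp (winLData Φ P.root P.Rπ P.lo P.hi P.root P.Sfin) j' σ ∧ σ.N ≤ P.N ∧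
      (1 - (S.p : ℝ) ^ σ.sB) ^ σ.k ≤ δ₂ ∧ Sz ⊆ (winLData Φ P.root P.Rπ P.lo P.hi P.root P.Sfin).X j' ∧ Sz ⊆ P.Rg Φ ∧
      (∀ x ∈ σ.K, ∀ e' ∈ σ.seed x, e' ∉ wireSet (↑Sz : Set V)) ∧ (∀ x ∈ σ.K, σ.face x ⊆ Sz) ∧
      (∀ x ∈ σ.K, 1 - 3 * δ₂ ≤ (prodBernoulli (S.Wt G h e a a' du j o)).real {ω | ∃ u ∈ σ.face x,
        1 - δ₂ < (prodBernoulli (pinW (S.Wt G h e a a' du j o) (wireSet (↑Sz : Set V)) ω)).real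
          (⋃ t ∈ P.T, openConnIn (↑(P.Rg Φ) : Set V) u t)}) := by
  intro P j' hj'
  obtain ⟨hj'0, hj'1⟩ := Finset.mem_Icc.1 hj'
  change Mj + 1 ≤ j' at hj'0
  change j' ≤ Rlev at hj'1
  have hWD : KNLevels.IsSubbox (winGraph G w₀ (Λ.rE a' (tgt e) du)) (S.Wt G h e a a' du j o) S.p
      (Φ.Win w₀ (C.farAS (tgt e) du j) (Λ.rE a' (tgt e) du)) := isSubbox_faceStepW Φ hΓ hΛ hV hdu Rlev N Mj L'
  have hWG : ∀ e', e' ∉ G.edgeSet → S.Wt G h e a a' du j o e' = 0 := fun e' he => KNCells.KSchA.Wt_eq_zero_of_not_mem_edgeSet he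
  have hXD : winLevel Φ w₀ (Λ.rE a' (tgt e) du) (C.faceLo (tgt e) du j) (C.faceHi (tgt e) du j) j' ⊆
      Φ.Win w₀ (C.farAS (tgt e) du j) (Λ.rE a' (tgt e) du) :=
    winLevel_faceRow_subset_Win Φ (C := C) (w₀ := w₀) (x := tgt e) (du := du) hjK (by omega) _
  have hwide : ∀ i, (C.faceLo (tgt e) du j - (j' : Site 2)) i + 2 * tanOff ℓs M ≤ (C.faceHi (tgt e) du j + (j' : Site 2)) i := by
    intro i
    have h1 := faceRow_hwide C (tgt e) du j (M := Mj) hj'0 i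
    have h2 : (tanOff ℓs M : ℤ) ≤ Mj + 1 := by exact_mod_cast hMj
    linarith
  -- the per-contact dichotomy: rim contacts by `hcon_win₂'`, deep contacts by the inner route `hroute_face`
  have hcon := SkelI.hcon_win₂' Φ hC (msel := msel) (Ssc := Ssc) (q := S.p) (δ := δ₂) (am := am)
    (Wt := S.Wt G h e a a' du j o) (D := Φ.Win w₀ (C.farAS (tgt e) du j) (Λ.rE a' (tgt e) du)) (T := P.T)
    (Rt := Λ.rM a' (tgt e + stepVec du) - 1) (L'' := L' - 1) (Ldeep := L_A) (lo := C.faceLo (tgt e) du j) (hi := C.faceHi (tgt e) du j)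
    (j := j') (Unear := SkelI.cubeU Φ hC w₀ (Λ.rE a' (tgt e) du) (C.faceLo (tgt e) du j) (C.faceHi (tgt e) du j) j' ℓs M)
    (fun _ _ _ => rfl) (SkelI.nearFaceOK_cube Φ hC hMℓ hwide hR'₂ hr₀₂ hR hrs₂ le_rfl) (fun v hv hfar => ?_) (by omega) (by omega) (by omega)
    (fun x' hx' hnear hdeep t ht hin' => ?_)
  · exact SkelI.kitClause_cube' Φ hC msel hδ ham₂ hin hM hmsel hMℓ hwide hR'₁ hR'₂ hr₀₁ hr₀₂ hR hrs₁ hrs₂ k w₀ _ hWD hXD hN hk hcon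
  · -- rim vertices are in the enlarged target
    exact Finset.mem_union_right _ (Finset.mem_filter.2 ⟨hXD hv, fun hb => hfar (graphBall_mono G w₀ (by omega) hb)⟩)
  · -- deep contact: the inner route from the cube centre
    have hctr : cubeCtr Φ (deepCtr Φ w₀ (Λ.rE a' (tgt e) du) (C.faceLo (tgt e) du j - (j' : Site 2)) (C.faceHi (tgt e) du j + (j' : Site 2)) ℓs M x') (exitDir Φ w₀ (Λ.rE a' (tgt e) du) (C.faceLo (tgt e) du j - (j' : Site 2)) (C.faceHi (tgt e) du j + (j' : Site 2)) x').1
        (exitDir Φ w₀ (Λ.rE a' (tgt e) du) (C.faceLo (tgt e) du j - (j' : Site 2)) (C.faceHi (tgt e) du j + (j' : Site 2)) x').2 ℓs M ∈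
        Φ.Win w₀ (Finset.Icc (C.faceLo (tgt e) du j - (j' : Site 2) + ((2 * ℓs + 2 : ℕ) : Site 2))
          (C.faceHi (tgt e) du j + (j' : Site 2) - ((2 * ℓs + 2 : ℕ) : Site 2))) (Λ.rE a' (tgt e) du) :=
      SkelI.cube_subset_shellWin Φ hC hwide hr₀₂ hR hx' hnear ((mem_fatSeq_iff Φ hC).2 (self_mem_cylBall Φ _ M _))
    have hφo := Icc_shrink_subset (C.faceLo (tgt e) du j) (C.faceHi (tgt e) du j) (n := 2 * ℓs + 2) hj'1 (Φ.mem_Win.1 hctr).2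
    have hrM1 : Λ.rM a' (tgt e + stepVec du) - 1 + 1 ≤ Λ.rM a' (tgt e + stepVec du) := by omega
    obtain ⟨Qt, Ft, hFt, hQt, hadj, hdisj, hlt⟩ := hroute_face' Φ hjK hC hMℓ₀ hs hs2 hℓ1 hn hbig h10s hRlA hℓL hLA hτ
      (R₁' := Λ.rM a' (tgt e + stepVec du) - 1) (by omega) hrM1 hWD hWG (faceStepW_Rg_subset_Sfin Φ hΓ hΛ Rlev N Mj L')
      hφo hdeep (hmsel t ht) (hchain _) hcountA hkitsA hηA hR₁A hRA
      ((sub_le_sub_left hamA 1).trans_lt ((hin' ℓ1 hℓ1S).2 (faceElt du.1 τ)))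
    exact ⟨Qt, Ft, fun v hv => Finset.mem_union_left _ (hFt hv), hQt, hadj, hdisj, hlt⟩

end History

end Skel

end Transplant

end Summit.CriticalPhenomena.PercolationContinuityZ3.Theorems

end
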